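import Literature.Computability.Complexity.SymmetricThresholdProgramsMinCell
import Summits.PneNP.PneNP.Theorems.SymmetryBudgetNoHiddenOrderValueGadgetsDefs
import Summits.PneNP.PneNP.Theorems.SymmetryBudgetNoHiddenOrderDecodeWalkDefs

/-!
# `NoHiddenOrder` (stmt-PneNP-14781), (R2c) value layer IV: the DECODE module of a label — definitions

Route `PneNP/SymmetryBudget`.  The gate-level realisation of the replay walk of a label `L = (U, X, λ)`
(`CGBits.wstep` / `CGBits.walk`, `…DecodeWalkDefs.lean`) as a symmetric threshold program:

* `DAnalysis` — the ANALYSIS of one walk state given by wires (membership `mem`, one-hot colour values `val`,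
  consumed set `cons`, dead flag `dead`): order/kernel of the colouring (`ValOrd`), switching components (`Comps`),
  the section test `isAND` (some block vertex does not reach the whole block), `big2` (`|block| ≥ 2`), `isOR`,
  the stop test `stop` against the static `U`, `X`, `frozen`, the first smallest cell (`MinCell`), the candidates
  `cand`, the dominating candidate `dom` (by the STATIC values `λ`), `go`, and the AND-test `andok` (all of `U` in one
  component);
* `Decode` — `F + 1` analysed states: state wires `memS k`, `valS k`, `consS k`, `deadS k` (stage `0` read from
  outside), and for every `k < F` the TRANSITION gates: the individualised order/kernel at the dominating candidate,
  a `RefVal` module (refine inside the block, read the new values), the step selectors `takeAnd`/`takeOr`, the new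
  block `newMem` (the component met by `U`) and the multiplexers producing stage `k + 1` exactly as `wstep` does.
Semantics in `…DecodeAnalysis.lean` / `…Decode.lean`.  Definitions only; supports stmt-PneNP-14781.
-/

set_option linter.dupNamespace false -- `Summit.PneNP.PneNP.…` (D-0017 single-conjunct layout)

namespace Summit.PneNP.PneNP.Theorems

open Finset Literature.Computability.Complexity Literature.Computability.Complexity.SymProg

variable {ι Λ : Type*} [DecidableEq ι] [DecidableEq Λ] (P : SymProg ι Λ)
variable (V : Type*) [Fintype V] [DecidableEq V] (N T D : ℕ) (U X : Finset V) (lam : V → ℕ)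

/-- **Analysis of a walk state** of the label `(U, X, λ)` (see the module docstring). [folklore] -/
structure DAnalysis where
  /-- INPUT: block membership -/
  mem : V → ι ⊕ Λ
  /-- INPUT: one-hot colour values -/
  val : V → Fin D → ι ⊕ Λ
  /-- INPUT: consumed label points -/
  cons : V → ι ⊕ Λ
  /-- INPUT: dead flag -/
  dead : ι ⊕ Λ
  /-- INPUT: adjacency (shared) -/
  adj : V → V → ι ⊕ Λ
  /-- order/kernel of the colouring -/
  O : ValOrd P V D
  /-- switching components of the block -/
  C : Comps P V N T
  /-- first smallest cell -/
  M : P.MinCell V N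
  /-- `nmem v = ¬ mem v` -/
  nmem : V → Λ
  /-- `ncons v = ¬ cons v` -/
  ncons : V → Λ
  /-- `cov u w = ¬mem w ∨ reach u w` -/
  cov : V → V → Λ
  /-- `all u = ∀ w, cov u w` (the component of `u` is the whole block) -/
  all : V → Λ
  /-- `nall u = ¬ all u` -/
  nall : V → Λ
  /-- `disc u = mem u ∧ nall u` -/
  disc : V → Λ
  /-- `isAND = ∃ u, disc u` -/
  isAND : Λ
  /-- `nisAND` -/
  nisAND : Λ
  /-- `big2 = [|block| ≥ 2]` -/
  big2 : Λ
  /-- `nbig2` -/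
  nbig2 : Λ
  /-- `isOR = nisAND ∧ big2` -/
  isOR : Λ
  /-- `stop`: the block is `U` and the consumed set is `X` -/
  stop : Λ
  /-- `frozen = dead ∨ stop` -/
  frozen : Λ
  /-- `nfrozen` -/
  nfrozen : Λ
  /-- `cand y`: `y ∈ X` not consumed, in the block and in the first smallest cell -/
  cand : V → Λ
  /-- `ncand y` -/
  ncand : V → Λ
  /-- `dom y`: `cand y` and no other candidate of value `≥ λ y` -/
  dom : V → Λ
  /-- `ndom y` -/
  ndom : V → Λ
  /-- `go = ∃ y, dom y` -/
  go : Λ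
  /-- `ngo` -/
  ngo : Λ
  /-- `andok`: `U ≠ ∅` and all of `U` in one component -/
  andok : Λ
  /-- `nandok` -/
  nandok : Λ
  O_val : O.val = val
  CS_mem : C.S.mem = mem
  CS_adj : C.S.adj = adj
  CS_eq : ∀ u v, C.S.eq u v = Sum.inr (O.eq u v)
  M_mem : M.mem = mem
  M_eq : ∀ u v, M.eq u v = Sum.inr (O.eq u v)
  M_lt : ∀ u v, M.lt u v = Sum.inr (O.lt u v)
  kind_nmem : ∀ v, P.kind (nmem v) = Kind.nor
  srcs_nmem : ∀ v, P.srcs (nmem v) = {mem v}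
  kind_ncons : ∀ v, P.kind (ncons v) = Kind.nor
  srcs_ncons : ∀ v, P.srcs (ncons v) = {cons v}
  kind_cov : ∀ u w, P.kind (cov u w) = Kind.or
  srcs_cov : ∀ u w, P.srcs (cov u w) = {Sum.inr (nmem w), Sum.inr (C.R.r (Fin.last T) u w)}
  kind_all : ∀ u, P.kind (all u) = Kind.and
  srcs_all : ∀ u, P.srcs (all u) = univ.image fun w => Sum.inr (cov u w)
  kind_nall : ∀ u, P.kind (nall u) = Kind.nor
  srcs_nall : ∀ u, P.srcs (nall u) = {Sum.inr (all u)}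
  kind_disc : ∀ u, P.kind (disc u) = Kind.and
  srcs_disc : ∀ u, P.srcs (disc u) = {mem u, Sum.inr (nall u)}
  kind_isAND : P.kind isAND = Kind.or
  srcs_isAND : P.srcs isAND = univ.image fun u => Sum.inr (disc u)
  kind_nisAND : P.kind nisAND = Kind.nor
  srcs_nisAND : P.srcs nisAND = {Sum.inr isAND}
  kind_big2 : P.kind big2 = Kind.atLeast 2
  srcs_big2 : P.srcs big2 = univ.image mem
  mem_injective : Function.Injective mem
  kind_nbig2 : P.kind nbig2 = Kind.nor
  srcs_nbig2 : P.srcs nbig2 = {Sum.inr big2}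
  kind_isOR : P.kind isOR = Kind.and
  srcs_isOR : P.srcs isOR = {Sum.inr nisAND, Sum.inr big2}
  kind_stop : P.kind stop = Kind.and
  srcs_stop : P.srcs stop =
    (U.image mem ∪ (univ \ U).image fun v => Sum.inr (nmem v)) ∪
      (X.image cons ∪ (univ \ X).image fun v => Sum.inr (ncons v))
  kind_frozen : P.kind frozen = Kind.or
  srcs_frozen : P.srcs frozen = {dead, Sum.inr stop}
  kind_nfrozen : P.kind nfrozen = Kind.nor
  srcs_nfrozen : P.srcs nfrozen = {Sum.inr frozen}
  kind_cand : ∀ y, P.kind (cand y) = if y ∈ X then Kind.and else Kind.or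
  srcs_cand : ∀ y, P.srcs (cand y) = if y ∈ X then {mem y, Sum.inr (M.sel y), Sum.inr (ncons y)} else ∅
  kind_ncand : ∀ y, P.kind (ncand y) = Kind.nor
  srcs_ncand : ∀ y, P.srcs (ncand y) = {Sum.inr (cand y)}
  kind_dom : ∀ y, P.kind (dom y) = Kind.and
  srcs_dom : ∀ y, P.srcs (dom y) =
    insert (Sum.inr (cand y)) ((X.filter fun z => z ≠ y ∧ lam y ≤ lam z).image fun z => Sum.inr (ncand z))
  kind_ndom : ∀ y, P.kind (ndom y) = Kind.nor
  srcs_ndom : ∀ y, P.srcs (ndom y) = {Sum.inr (dom y)}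
  kind_go : P.kind go = Kind.or
  srcs_go : P.srcs go = X.image fun y => Sum.inr (dom y)
  kind_ngo : P.kind ngo = Kind.nor
  srcs_ngo : P.srcs ngo = {Sum.inr go}
  kind_andok : P.kind andok = if U.Nonempty then Kind.and else Kind.or
  srcs_andok : P.srcs andok = if U.Nonempty then (U ×ˢ U).image fun uu => Sum.inr (C.R.r (Fin.last T) uu.1 uu.2) else ∅
  kind_nandok : P.kind nandok = Kind.nor
  srcs_nandok : P.srcs nandok = {Sum.inr andok}

variable (F : ℕ)

/-- **The decode module of a label**: `F + 1` analysed walk states and `F` transitions (see the module docstring).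
[folklore] -/
structure Decode where
  /-- adjacency (shared) -/
  adj : V → V → ι ⊕ Λ
  /-- STATE: block membership at stage `k` -/
  memS : Fin (F + 1) → V → ι ⊕ Λ
  /-- STATE: one-hot colour values at stage `k` -/
  valS : Fin (F + 1) → V → Fin D → ι ⊕ Λ
  /-- STATE: consumed label points at stage `k` -/
  consS : Fin (F + 1) → V → ι ⊕ Λ
  /-- STATE: dead flag at stage `k` -/
  deadS : Fin (F + 1) → ι ⊕ Λ
  /-- the analysis of stage `k` -/
  An : Fin (F + 1) → DAnalysis P V N T D U X lam
  /-- `tieD k u v = eq u v ∧ ¬dom u ∧ dom v` -/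
  tieD : Fin F → V → V → Λ
  /-- `ltI k u v`: order of the colouring individualised at the dominating candidate -/
  ltI : Fin F → V → V → Λ
  /-- `bothD k u v = dom u ∧ dom v` -/
  bothD : Fin F → V → V → Λ
  /-- `noneD k u v = ¬dom u ∧ ¬dom v` -/
  noneD : Fin F → V → V → Λ
  /-- `deqv k u v = (dom u ↔ dom v)` -/
  deqv : Fin F → V → V → Λ
  /-- `eqI k u v`: kernel of the individualised colouring -/
  eqI : Fin F → V → V → Λ
  /-- refinement of the individualised colouring inside the block, with value read-out -/
  RV : Fin F → RefVal P V N T D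
  /-- `takeAnd k = nfrozen ∧ isAND ∧ andok` -/
  takeAnd : Fin F → Λ
  /-- `ntakeAnd` -/
  ntakeAnd : Fin F → Λ
  /-- `takeOr k = nfrozen ∧ isOR ∧ go` -/
  takeOr : Fin F → Λ
  /-- `ntakeOr` -/
  ntakeOr : Fin F → Λ
  /-- `newMem k w = ∃ u ∈ U, reach u w` (the component met by `U`) -/
  newMem : Fin F → V → Λ
  /-- membership mux: keep -/
  m1 : Fin F → V → Λ
  /-- membership mux: step -/
  m2 : Fin F → V → Λ
  /-- membership mux: output -/
  mx : Fin F → V → Λ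
  /-- value mux: step -/
  v1 : Fin F → V → Fin D → Λ
  /-- value mux: keep -/
  v2 : Fin F → V → Fin D → Λ
  /-- value mux: output -/
  vx : Fin F → V → Fin D → Λ
  /-- consumed mux: step -/
  c1 : Fin F → V → Λ
  /-- consumed mux: output -/
  cx : Fin F → V → Λ
  /-- death at a section node: `nfrozen ∧ isAND ∧ nandok` -/
  d1 : Fin F → Λ
  /-- death at an individualisation node: `nfrozen ∧ isOR ∧ ngo` -/
  d2 : Fin F → Λ
  /-- death at a leaf: `nfrozen ∧ nisAND ∧ nbig2` -/
  d3 : Fin F → Λ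
  /-- dead mux: output -/
  dx : Fin F → Λ
  -- the analysis of stage `k` reads the state of stage `k`
  An_mem : ∀ k, (An k).mem = memS k
  An_val : ∀ k, (An k).val = valS k
  An_cons : ∀ k, (An k).cons = consS k
  An_dead : ∀ k, (An k).dead = deadS k
  An_adj : ∀ k, (An k).adj = adj
  -- individualised order/kernel (stage `k < F`, analysis of `k.castSucc`)
  kind_tieD : ∀ k u v, P.kind (tieD k u v) = Kind.and
  srcs_tieD : ∀ k u v, P.srcs (tieD k u v) =
    {Sum.inr ((An k.castSucc).O.eq u v), Sum.inr ((An k.castSucc).ndom u), Sum.inr ((An k.castSucc).dom v)}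
  kind_ltI : ∀ k u v, P.kind (ltI k u v) = Kind.or
  srcs_ltI : ∀ k u v, P.srcs (ltI k u v) = {Sum.inr ((An k.castSucc).O.lt u v), Sum.inr (tieD k u v)}
  kind_bothD : ∀ k u v, P.kind (bothD k u v) = Kind.and
  srcs_bothD : ∀ k u v, P.srcs (bothD k u v) = {Sum.inr ((An k.castSucc).dom u), Sum.inr ((An k.castSucc).dom v)}
  kind_noneD : ∀ k u v, P.kind (noneD k u v) = Kind.nor
  srcs_noneD : ∀ k u v, P.srcs (noneD k u v) = {Sum.inr ((An k.castSucc).dom u), Sum.inr ((An k.castSucc).dom v)}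
  kind_deqv : ∀ k u v, P.kind (deqv k u v) = Kind.or
  srcs_deqv : ∀ k u v, P.srcs (deqv k u v) = {Sum.inr (bothD k u v), Sum.inr (noneD k u v)}
  kind_eqI : ∀ k u v, P.kind (eqI k u v) = Kind.and
  srcs_eqI : ∀ k u v, P.srcs (eqI k u v) = {Sum.inr ((An k.castSucc).O.eq u v), Sum.inr (deqv k u v)}
  -- the refinement module reads the block and the individualised colouring
  RV_mem : ∀ k, (RV k).RI.mem = memS k.castSucc
  RV_adj : ∀ k, (RV k).RI.adj = adj
  RV_lt0 : ∀ k u v, (RV k).RI.lt0 u v = Sum.inr (ltI k u v)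
  RV_eq0 : ∀ k u v, (RV k).RI.eq0 u v = Sum.inr (eqI k u v)
  -- step selectors
  kind_takeAnd : ∀ k, P.kind (takeAnd k) = Kind.and
  srcs_takeAnd : ∀ k, P.srcs (takeAnd k) =
    {Sum.inr (An k.castSucc).nfrozen, Sum.inr (An k.castSucc).isAND, Sum.inr (An k.castSucc).andok}
  kind_ntakeAnd : ∀ k, P.kind (ntakeAnd k) = Kind.nor
  srcs_ntakeAnd : ∀ k, P.srcs (ntakeAnd k) = {Sum.inr (takeAnd k)}
  kind_takeOr : ∀ k, P.kind (takeOr k) = Kind.and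
  srcs_takeOr : ∀ k, P.srcs (takeOr k) =
    {Sum.inr (An k.castSucc).nfrozen, Sum.inr (An k.castSucc).isOR, Sum.inr (An k.castSucc).go}
  kind_ntakeOr : ∀ k, P.kind (ntakeOr k) = Kind.nor
  srcs_ntakeOr : ∀ k, P.srcs (ntakeOr k) = {Sum.inr (takeOr k)}
  kind_newMem : ∀ k w, P.kind (newMem k w) = Kind.or
  srcs_newMem : ∀ k w, P.srcs (newMem k w) = U.image fun u => Sum.inr ((An k.castSucc).C.R.r (Fin.last T) u w)
  -- multiplexers
  kind_m1 : ∀ k v, P.kind (m1 k v) = Kind.and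
  srcs_m1 : ∀ k v, P.srcs (m1 k v) = {memS k.castSucc v, Sum.inr (ntakeAnd k)}
  kind_m2 : ∀ k v, P.kind (m2 k v) = Kind.and
  srcs_m2 : ∀ k v, P.srcs (m2 k v) = {Sum.inr (takeAnd k), Sum.inr (newMem k v)}
  kind_mx : ∀ k v, P.kind (mx k v) = Kind.or
  srcs_mx : ∀ k v, P.srcs (mx k v) = {Sum.inr (m1 k v), Sum.inr (m2 k v)}
  kind_v1 : ∀ k v c, P.kind (v1 k v c) = Kind.and
  srcs_v1 : ∀ k v c, P.srcs (v1 k v c) = {Sum.inr (takeOr k), Sum.inr ((RV k).val v c)}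
  kind_v2 : ∀ k v c, P.kind (v2 k v c) = Kind.and
  srcs_v2 : ∀ k v c, P.srcs (v2 k v c) = {Sum.inr (ntakeOr k), valS k.castSucc v c}
  kind_vx : ∀ k v c, P.kind (vx k v c) = Kind.or
  srcs_vx : ∀ k v c, P.srcs (vx k v c) = {Sum.inr (v1 k v c), Sum.inr (v2 k v c)}
  kind_c1 : ∀ k v, P.kind (c1 k v) = Kind.and
  srcs_c1 : ∀ k v, P.srcs (c1 k v) = {Sum.inr (takeOr k), Sum.inr ((An k.castSucc).dom v)}
  kind_cx : ∀ k v, P.kind (cx k v) = Kind.or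
  srcs_cx : ∀ k v, P.srcs (cx k v) = {consS k.castSucc v, Sum.inr (c1 k v)}
  kind_d1 : ∀ k, P.kind (d1 k) = Kind.and
  srcs_d1 : ∀ k, P.srcs (d1 k) =
    {Sum.inr (An k.castSucc).nfrozen, Sum.inr (An k.castSucc).isAND, Sum.inr (An k.castSucc).nandok}
  kind_d2 : ∀ k, P.kind (d2 k) = Kind.and
  srcs_d2 : ∀ k, P.srcs (d2 k) =
    {Sum.inr (An k.castSucc).nfrozen, Sum.inr (An k.castSucc).isOR, Sum.inr (An k.castSucc).ngo}
  kind_d3 : ∀ k, P.kind (d3 k) = Kind.and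
  srcs_d3 : ∀ k, P.srcs (d3 k) =
    {Sum.inr (An k.castSucc).nfrozen, Sum.inr (An k.castSucc).nisAND, Sum.inr (An k.castSucc).nbig2}
  kind_dx : ∀ k, P.kind (dx k) = Kind.or
  srcs_dx : ∀ k, P.srcs (dx k) = {deadS k.castSucc, Sum.inr (d1 k), Sum.inr (d2 k), Sum.inr (d3 k)}
  -- the next state is the multiplexer output
  memS_succ : ∀ (k : Fin F) v, memS k.succ v = Sum.inr (mx k v)
  valS_succ : ∀ (k : Fin F) v c, valS k.succ v c = Sum.inr (vx k v c)
  consS_succ : ∀ (k : Fin F) v, consS k.succ v = Sum.inr (cx k v)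
  deadS_succ : ∀ (k : Fin F), deadS k.succ = Sum.inr (dx k)

/-! ### What the wires read -/

namespace DAnalysis

variable {P V N T D U X lam} (Da : DAnalysis P V N T D U X lam) (x : ι → Bool)

/-- **The input wires of an analysis read the walk state `S`**: membership the block, value wires the colouring
(one-hot), `cons` the consumed set, `dead` the flag. [folklore] -/
structure Reads (S : CGBits.WState V) : Prop where
  /-- membership -/
  mem_iff : ∀ u, wval x (P.sem x) (Da.mem u) = true ↔ u ∈ S.A
  /-- values -/
  val_iff : ∀ u (c : Fin D), wval x (P.sem x) (Da.val u c) = true ↔ S.col u = c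
  /-- consumed -/
  cons_iff : ∀ u, wval x (P.sem x) (Da.cons u) = true ↔ u ∈ S.C
  /-- dead -/
  dead_iff : wval x (P.sem x) Da.dead = true ↔ S.dead = true

end DAnalysis

namespace Decode

variable {P V N T D U X lam F} (Dc : Decode P V N T D U X lam F) (x : ι → Bool)

/-- **The state wires of stage `k` read the walk state `S`.** [folklore] -/
structure StateReads (k : Fin (F + 1)) (S : CGBits.WState V) : Prop where
  /-- membership -/
  mem_iff : ∀ u, wval x (P.sem x) (Dc.memS k u) = true ↔ u ∈ S.A
  /-- values -/
  val_iff : ∀ u (c : Fin D), wval x (P.sem x) (Dc.valS k u c) = true ↔ S.col u = c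
  /-- consumed -/
  cons_iff : ∀ u, wval x (P.sem x) (Dc.consS k u) = true ↔ u ∈ S.C
  /-- dead -/
  dead_iff : wval x (P.sem x) (Dc.deadS k) = true ↔ S.dead = true

end Decode

end Summit.PneNP.PneNP.Theorems
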